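import Literature.Barriers.QuantumFields.FiniteTemperatureDeconfinementInfrared
import Literature.MathematicalPhysics.QuantumFieldTheory.Z2WilsonLoopGKS
import Literature.MathematicalPhysics.QuantumFieldTheory.FiniteGaugeGroupTorus
import Literature.Probability.LatticeModels.GKSInequalities
import Literature.Probability.LatticeModels.InfraredLongRangeOrder
import Literature.Probability.LatticeModels.GaussianDominationProofs
import Literature.Probability.LatticeModels.TorusTransferSpectral
import Literature.Probability.LatticeModels.GaussianPairingBoundCouplings
import Literature.Probability.LatticeModels.LatticeGreenPositive
import Mathlib.Analysis.SpecialFunctions.Artanh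
import HarnessLib

/-!
# `ℤ₂` lattice gauge theory deconfines at non-zero lattice temperature, at EVERY temporal extent:
# Griffiths' inequality, the ultralocal model, and the Ising model of the Polyakov loops
# (Borgs–Seiler 1983, abelian case, §III.3 and §IV pp. 358–359)

C. Borgs, E. Seiler, *Lattice Yang–Mills theory at nonzero temperature and the confinement
problem*, Commun. Math. Phys. **91** (1983) 329–380 [BorgsSeiler1983] (held; PDF page = printed
page − 328), prove deconfinement — long-range order of the Polyakov loops — at every temporal
extent `L₀` and large electric coupling `J_E` "in any lattice gauge model in at least four
space-time dimensions" (p. 330). The tree vendors the `U(N)`/`SU(N)` statement as the named fact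
`Literature.Barriers.QuantumFields.FiniteTemperatureDeconfinement` (Thm III.7 / Cor. III.5), so far
discharged only at `L₀ = 1` (`FiniteTemperatureOneLayerInfrared`); the many-layer infrared bound
`BorgsSeilerInfraredBound` (Lemma III.6) is open in the tree. For ABELIAN gauge groups the source
gives a second route, by correlation inequalities, which this file carries out for `G = ℤ₂`
(every `L₀ ≥ 1`, every space dimension `d ≥ 3`):

* §III.3 "Some further results for abelian models" (pp. 354–357): "We consider gauge groups
  `U(1)` (or `ℤ_N` …)" with an electric plaquette coupling `e^{-S_P} = ∑_τ m_τ(J_E) τ(g_{∂P})`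
  ((III.69)); Lemma III.9 (III.84): an infrared bound `∑ᵢ(1 - cos pᵢ) Ĝ(p) ≤ d[(1 + g(J_E))^{L₀} - 1]`,
  whence "deconfinement" ((III.87)).
* §IV, pp. 358–359, the mechanism used HERE: "For `J_M = 0` we obtain the "ultralocal" model …
  For finite temperature it becomes structurally identical to a one time layer model … For more
  general ultralocal actions we still have the structure of the one layer model, but with a more
  complicated electric coupling arising from the `L₀`-fold convolution of [the plaquette weight]
  with itself. In any case these models can all be regarded as `G × G` spin models with some random
  coupling provided by the `v` variables … The random couplings might be expected to create
  disorder, thereby making deconfinement harder. **For abelian models this follows from Ginibre's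
  inequalities [20].**" and (p. 359) "It is now highly plausible that the true transition point
  will lie between the values obtained for `J_M = 0` and `J_M → ∞`. For abelian models this is of
  course again implied by Ginibre's inequalities." ([20] = Ginibre, CMP 16 (1970) 310.)

For `G = ℤ₂` (character `χ = ±1`, Ginibre = Griffiths–Kelly–Sherman) the `L₀`-fold convolution of
the electric weight `cosh J_E + χ sinh J_E` is `∝ 1 + (tanh J_E)^{L₀} χ`, so the one-layer model of
the Polyakov loops `P_x = ∏_t U((t,x),time) ∈ {±1}` of the ultralocal theory is EXACTLY the
nearest-neighbour Ising model on the spatial torus `(ℤ/L)^d` at the inverse temperature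

  `K(J_E, L₀) = artanh((tanh J_E)^{L₀})`  (`tanh K = (tanh J_E)^{L₀}`).

## What is proved (everything; no named fact is introduced, no definition of the barrier file is
## restated — the statements are about `FiniteTemperature.polyakovCorrelation`,
## `FiniteTemperature.HasPolyakovLongRangeOrder` of
## `Literature.Barriers.QuantumFields.FiniteTemperatureDeconfinement`)

1. `Z2Thermal.expectation_eq_sum_div` — over a FINITE gauge group the finite-temperature
   expectation `⟨F⟩ = ∫ F e^{-S} ∏dU / ∫ e^{-S} ∏dU` is the finite Gibbs average (the uniform Haar
   weights cancel; as `wilsonExpectation_eq_gibbsAverage` for the zero-temperature torus).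
2. `Z2Thermal.expectation_eq_gksExpect`, `Z2Thermal.polyakovCorrelation_eq_gksExpect` — the
   finite-temperature `ℤ₂` theory (`z2Rep`, couplings `J_E` on time-like and `J_M` on space-like
   plaquettes) is a ferromagnetic generalised Ising system on the link spins in the sense of the
   tree's GKS file (`Literature.Probability.LatticeModels.gksExpect`, Friedli–Velenik §3.8.1), and
   the Polyakov-loop two-point function `G_L(x)` ((II.22)) is the expectation of a spin product.
3. GKS consequences (`J_E, J_M ≥ 0`): `G_L(x) ≥ 0` (`Z2Thermal.polyakovCorrelation_nonneg`), and
   `G_L(x)` is non-decreasing in `J_M` and in `J_E` (`Z2Thermal.polyakovCorrelation_mono_magnetic`,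
   `…_mono_electric`) — Borgs–Seiler's "For abelian models this follows from Ginibre's
   inequalities": the random spatial couplings only help, `G_L(x; J_E, J_M) ≥ G_L(x; J_E, 0)`.
4. **The ultralocal model is the Ising model of the Polyakov loops**
   (`Z2Thermal.polyakovCorrelation_ultralocal_eq_isingTorus`): for `J_M = 0`, every `L₀ ≥ 1` and
   every spatial torus of side `L ≥ 3`,
   `G_L(x; J_E, 0) = ⟨σ_0 σ_x⟩^{Ising}_{(ℤ/L)^d, K(J_E,L₀)}`
   (the tree's `torusTwoPoint (isingTorusMeasure d L K 0)`), by integrating out the space-like links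
   chain by chain (`Z2Thermal.chainSum_eq`: the high-temperature expansion of the `ℤ₂` chain of
   length `L₀` closed by the Polyakov loops, `∑_s ∏_t e^{J ε_t s_{t+1} s_t} = (2 cosh J)^{L₀}(1 + (tanh J)^{L₀} ∏_t ε_t)`)
   and pushing the uniform measure of the time-like links forward to the Polyakov loops
   (a surjective homomorphism of finite abelian groups has equicardinal fibres;
   `Z2Thermal.polyakovCorrelation_ultralocal_eq_loopAverage`).
5. Hence (`Z2Thermal.isingTorus_le_polyakovCorrelation`) **`⟨σ_0σ_x⟩^{Ising}_{(ℤ/L)^d,K(J_E,L₀)} ≤ G_L(x; J_E, J_M)`**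
   for all `J_E, J_M ≥ 0`, `L ≥ 3`.
6. **Deconfinement** (`z2_hasPolyakovLongRangeOrder`, `z2_finiteTemperatureDeconfinement`): in
   `d ≥ 3` space dimensions, at every temporal extent `L₀ ≥ 1`, for `J_E > 0` with
   `2 K(J_E, L₀) > I_d` (`I_d = latticeGreen 0 = (2π)^{-d}∫ dp/∑ᵢ(1 - cos pᵢ)`) and every
   `J_M ≥ 0`, `FiniteTemperature.HasPolyakovLongRangeOrder d L₀ z2Rep J_E J_M` holds: no
   thermodynamic limit of `G_L` tends to `0` at spatial infinity. The Ising input is the tree's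
   infrared bound `infraredBound_holds` (Fröhlich–Simon–Spencer 1976) with the tree's sum-rule /
   block-average mechanism of `InfraredLongRangeOrder.lean`, here in a comparison form
   (`Z2Thermal.not_tendsto_zero_of_le_of_infraredBound`: a pointwise MINORANT with an infrared
   bound and diagonal `≥ g₀` forces long-range order of the majorant). An explicit sufficient
   threshold is `J_E ≥ I_d/2 + log(2L₀)/2 + 1` (`z2_hasPolyakovLongRangeOrder_of_ge`, from
   `K ≥ J_E - log(2L₀)/2` for `J_E ≥ 1`), growing like `log L₀` — "obviously [the threshold] cannot be independent of `T`
   here" (p. 357).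
7. **Barrier corollaries, unconditional for `ℤ₂` at every `L₀`** (the `U(N)`/`SU(N)` versions in
   `FiniteTemperatureDeconfinement.lean` are conditional on the fact): Polyakov confinement at all
   couplings, temperature-blind Polyakov confinement, and their volume-uniform clustering forms
   are FALSE for `(ℤ₂, z2Rep)` in every `d ≥ 3` (`z2_not_polyakovConfinementAtAllCouplings`, …).

## Honest framing

This is the ABELIAN group `ℤ₂`; nothing here bears on `U(N)`/`SU(N)` (centre domination bounds
non-abelian Polyakov correlators from ABOVE by `ℤ₂` ones, `CentreDominatedPolyakovLoops.lean`, the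
wrong direction for long-range order), on the zero-temperature theory (`L₀ → ∞`: the threshold
diverges), on `BalabanLadder.IR`, or on the Yang–Mills mass gap (Clay), which is NOT proved by any
of this; in the `ym` ladder only the conditional finite-`𝕋⁴` rung `BalabanLadder.UV` is closed.
`d = 2` (where the Ising minorant also orders, by Peierls) is not treated: the tree's long-range
order mechanism on tori is the infrared bound, `d ≥ 3`. `U(1)` and `ℤ_N`, `N ≥ 3`, are not treated
(their ultralocal one-layer models are generalised clock / `XY` models with the `L₀`-fold convolved
weight, for which the tree has no infrared bound) — TODO(general form): Borgs–Seiler Lemma III.9.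

## References

* C. Borgs, E. Seiler, Commun. Math. Phys. 91 (1983) 329–380: §II.3 (II.22)–(II.23) p. 337;
  §III.3 (III.69)–(III.87) pp. 354–356; §IV pp. 357–359. [BorgsSeiler1983]
* J. Ginibre, *General formulation of Griffiths' inequalities*, Comm. Math. Phys. 16 (1970)
  310–328 (= [20] of Borgs–Seiler).
* S. Friedli, Y. Velenik, *Statistical Mechanics of Lattice Systems* (CUP 2017), §3.8.1 Thm 3.49
  and Exercise 3.31 (GKS, comparison of couplings); §3.7.3 (high-temperature expansion);
  Thm 10.24 (infrared bound). [FriedliVelenik2017]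
* J. Fröhlich, B. Simon, T. Spencer, Comm. Math. Phys. 50 (1976) 79–95, §3. [FrohlichSimonSpencer1976]
-/

noncomputable section

open MeasureTheory Filter Finset
open scoped Topology symmDiff ENNReal
open Literature.Probability.LatticeModels Literature.MathematicalPhysics.QuantumLattice
open Literature.Barriers.QuantumFields Literature.Barriers.QuantumFields.FiniteTemperature

namespace Literature.MathematicalPhysics.QuantumFieldTheory

namespace Z2Thermal

variable {d L₀ L : ℕ}

/-! ### 1. Finite gauge groups: finite-temperature expectations are finite Gibbs averages -/

section FiniteGroup

variable {G : Type*} [Group G] [Fintype G] [TopologicalSpace G] [DiscreteTopology G]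
  [IsTopologicalGroup G] [MeasurableSpace G] [BorelSpace G] {N : ℕ}
  (ρ : G →* Matrix (Fin N) (Fin N) ℂ)

/-- Over a finite discrete group the a-priori product Haar measure of the finite-temperature
lattice gives every configuration the same mass `|G|^{-#links}`. [folklore] -/
private theorem haar_singleton [NeZero L₀] [NeZero L] (U : Config d L₀ L G) :
    haar d L₀ L G {U} = ((Fintype.card G : ℝ≥0∞)⁻¹) ^ Fintype.card (FiniteTemperature.Site d L₀ L × Dir d) := by
  haveI : DiscreteMeasurableSpace G := discreteMeasurableSpace_of_borel
  rw [haar, ← Set.univ_pi_singleton U, Measure.pi_pi]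
  simp only [haarProbability_singleton, Finset.prod_const, Finset.card_univ]

/-- Over a finite discrete group, integrals against the a-priori measure are uniform averages:
`∫ F ∏dU = |G|^{-#links} ∑_U F(U)`. [folklore] -/
private theorem integral_haar_eq_mul_sum [NeZero L₀] [NeZero L] (F : Config d L₀ L G → ℝ) :
    ∫ U, F U ∂haar d L₀ L G =
      ((((Fintype.card G : ℝ≥0∞)⁻¹) ^ Fintype.card (FiniteTemperature.Site d L₀ L × Dir d)).toReal) *
        ∑ U : Config d L₀ L G, F U := by
  haveI : DiscreteMeasurableSpace G := discreteMeasurableSpace_of_borel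
  rw [integral_fintype (Integrable.of_finite), Finset.mul_sum]
  refine Finset.sum_congr rfl fun U _ => ?_
  rw [measureReal_def, haar_singleton, smul_eq_mul]

/-- **Finite-temperature expectations over a finite gauge group are finite Gibbs averages**:
`⟨F⟩_{L₀,L;J_E,J_M} = ∑_U F(U) e^{-S(U)} / ∑_U e^{-S(U)}` (the uniform Haar weights cancel; cf.
`wilsonExpectation_eq_gibbsAverage` for the zero-temperature torus).
[cite: SeilerLNP1982, Ch. 1 (finite-volume lattice gauge theory: the Gibbs measure)] -/
theorem expectation_eq_sum_div [NeZero L₀] [NeZero L] (JE JM : ℝ) (F : Config d L₀ L G → ℝ) :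
    expectation ρ JE JM F =
      (∑ U : Config d L₀ L G, F U * weight ρ JE JM U) / ∑ U : Config d L₀ L G, weight ρ JE JM U := by
  rw [expectation, integral_haar_eq_mul_sum, integral_haar_eq_mul_sum]
  have hc : 0 < ((((Fintype.card G : ℝ≥0∞)⁻¹) ^ Fintype.card (FiniteTemperature.Site d L₀ L × Dir d)).toReal) := by
    refine ENNReal.toReal_pos (pow_ne_zero _ (ENNReal.inv_ne_zero.2 (ENNReal.natCast_ne_top _))) ?_
    exact ENNReal.pow_ne_top (ENNReal.inv_ne_top.2 (by exact_mod_cast Fintype.card_ne_zero))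
  rw [mul_div_mul_left _ _ hc.ne']

end FiniteGroup

/-! ### 2. The finite-temperature `ℤ₂` theory as a ferromagnetic spin system on the links -/

/-- The gauge group `ℤ₂ = Multiplicative (ZMod 2)` of Ising lattice gauge theory (the tree's
`z2Rep`, `z2Character`). [folklore] -/
abbrev Z2 : Type := Multiplicative (ZMod 2)

/-- The links of the finite-temperature lattice `ℤ_{L₀} × (ℤ/L)^d` (site, direction). [folklore] -/
abbrev Link (d L₀ L : ℕ) : Type := FiniteTemperature.Site d L₀ L × Dir d

/-- The `±1` spin configuration on the links attached to a `ℤ₂` configuration. [folklore] -/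
def spinOf (U : Config d L₀ L Z2) : SpinConfig (Link d L₀ L) := fun e => z2Spin (U e)

/-- The link spin is the character of the link variable. [folklore] -/
@[simp] private theorem spinAt_spinOf (U : Config d L₀ L Z2) (e : Link d L₀ L) :
    spinAt e (spinOf U) = z2Character (U e) :=
  cast_z2Spin (U e)

/-- `U ↦ spinOf U` is a bijection (linkwise `ℤ₂ ≃ {±1}`). [folklore] -/
def spinOfEquiv : Config d L₀ L Z2 ≃ SpinConfig (Link d L₀ L) :=
  Equiv.piCongrRight fun _ => z2UnitEquiv

/-- `spinOfEquiv` is `spinOf`. [folklore] -/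
@[simp] private theorem spinOfEquiv_apply (U : Config d L₀ L Z2) : spinOfEquiv U = spinOf U := rfl

/-- `tr z2Rep(a) = χ(a)` as a complex number (`1 × 1` matrices). [folklore] -/
private theorem trace_z2Rep (a : Z2) : (z2Rep a).trace = ((z2Character a : ℝ) : ℂ) := by
  rw [z2Character_eq_trace_re]
  rw [z2Rep_apply, Matrix.trace_smul, Matrix.trace_one, Fintype.card_fin, Nat.cast_one, smul_eq_mul,
    mul_one]
  rcases neg_one_pow_eq_or ℂ (Multiplicative.toAdd a).val with h | h <;> simp [h]

/-- `Re tr z2Rep = χ`. [folklore] -/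
private theorem trace_z2Rep_re (a : Z2) : (z2Rep a).trace.re = z2Character a := by
  rw [trace_z2Rep, Complex.ofReal_re]

/-- The link set of a plaquette "with signs forgotten mod 2": the iterated symmetric difference
of its four links `(x,μ), (x+e_μ,ν), (x+e_ν,μ), (x,ν)` (a genuine four-element set unless the
torus is degenerate in one of the two directions, e.g. `L₀ = 1` for a time-like plaquette, when
the repeated link drops out — exactly as its `±1` spin squares to `1`). [folklore] -/
def plaqSet (x : FiniteTemperature.Site d L₀ L) (μ ν : Dir d) : Finset (Link d L₀ L) :=
  (({(x, μ)} ∆ {(x.shift μ, ν)}) ∆ {(x.shift ν, μ)}) ∆ {(x, ν)}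

/-- For `ℤ₂` the plaquette character is the spin product over `plaqSet` (inverses are trivial,
`χ² = 1`; Chatterjee 2020 (1.1): `σ_p = σ_{e₁} σ_{e₂} σ_{e₃} σ_{e₄}`). [cite: arXiv181109770, §1.1 (1.1)] -/
theorem z2Character_plaquette (U : Config d L₀ L Z2) (x : FiniteTemperature.Site d L₀ L) (μ ν : Dir d) :
    z2Character (plaquette U x μ ν) = spinProduct (plaqSet x μ ν) (spinOf U) := by
  rw [plaquette, z2Character_mul, z2Character_mul, z2Character_mul, z2Character_inv,
    z2Character_inv, plaqSet, ← spinProduct_mul_eq_spinProduct_symmDiff,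
    ← spinProduct_mul_eq_spinProduct_symmDiff, ← spinProduct_mul_eq_spinProduct_symmDiff]
  simp [spinProduct]

variable (d L₀ L) in
/-- Index set of the plaquette couplings: time-like plaquettes `(x; time, i)` and space-like
plaquettes `(x; i < j)`. [folklore] -/
abbrev PlaqIdx : Type := (FiniteTemperature.Site d L₀ L × Fin d) ⊕ (FiniteTemperature.Site d L₀ L × {p : Fin d × Fin d // p.1 < p.2})

/-- The couplings: `J_E` on time-like, `J_M` on space-like plaquettes.
[cite: BorgsSeiler1983, §II.3 (II.20) (pp. 335–336)] -/
def cpl (JE JM : ℝ) : PlaqIdx d L₀ L → ℝ := fun i => Sum.elim (fun _ => JE) (fun _ => JM) i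

/-- The interaction sets: the links of each plaquette. [folklore] -/
def plaqLinks : PlaqIdx d L₀ L → Finset (Link d L₀ L) := fun i =>
  Sum.elim (fun q => plaqSet q.1 none (some q.2)) (fun q => plaqSet q.1 (some q.2.1.1) (some q.2.1.2)) i

/-- The couplings are non-negative for `J_E, J_M ≥ 0` (ferromagnetic system). [folklore] -/
private theorem cpl_nonneg {JE JM : ℝ} (hJE : 0 ≤ JE) (hJM : 0 ≤ JM) (i : PlaqIdx d L₀ L) :
    0 ≤ cpl JE JM i := by
  rcases i with i | i <;> simp [cpl, hJE, hJM]

/-- **Minus the `ℤ₂` action is a ferromagnetic generalised Ising Hamiltonian in the link spins**: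
`J_E ∑_{time-like P} χ(U_P) + J_M ∑_{space-like P} χ(U_P) = ∑ᵢ Kᵢ σ_{Cᵢ}`. [cite: BorgsSeiler1983, §II.3 (II.20) (pp. 335–336)] -/
theorem minusAction_eq_gksHamiltonian [NeZero L₀] [NeZero L] (JE JM : ℝ) (U : Config d L₀ L Z2) :
    minusAction z2Rep JE JM U = gksHamiltonian univ (cpl JE JM) plaqLinks (spinOf U) := by
  rw [minusAction, gksHamiltonian, Fintype.sum_sum_type]
  simp only [cpl, plaqLinks, Sum.elim_inl, Sum.elim_inr, trace_z2Rep_re, z2Character_plaquette,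
    Fintype.sum_prod_type, Finset.mul_sum]

/-- The Boltzmann weight is the GKS weight `exp(∑ᵢ Kᵢ σ_{Cᵢ})` of the link spins
(Friedli–Velenik §3.8.1, `ν_{Λ;K}`). [cite: FriedliVelenik2017, §3.8.1, p. 141] -/
theorem weight_eq_gksWeight [NeZero L₀] [NeZero L] (JE JM : ℝ) (U : Config d L₀ L Z2) :
    weight z2Rep JE JM U = gksWeight univ (cpl JE JM) plaqLinks (spinOf U) := by
  rw [weight, gksWeight, minusAction_eq_gksHamiltonian]

/-- **Finite-temperature `ℤ₂` expectations are GKS expectations**: for an observable of the link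
spins, `⟨f ∘ spinOf⟩_{L₀,L;J_E,J_M} = ⟨f⟩_{ν_K}` with `ν_K ∝ exp(∑ᵢ Kᵢ σ_{Cᵢ})` the generalised
Ising system of the plaquette couplings (Friedli–Velenik §3.8.1). [cite: FriedliVelenik2017, §3.8.1, p. 141] -/
theorem expectation_eq_gksExpect [NeZero L₀] [NeZero L] (JE JM : ℝ)
    (f : SpinConfig (Link d L₀ L) → ℝ) :
    expectation z2Rep JE JM (fun U => f (spinOf U)) = gksExpect univ (cpl JE JM) plaqLinks f := by
  rw [expectation_eq_sum_div, gksExpect, gksSum, gksSum,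
    ← spinOfEquiv.sum_comp (fun ω => f ω * gksWeight univ (cpl JE JM) plaqLinks ω),
    ← spinOfEquiv.sum_comp (fun ω => 1 * gksWeight univ (cpl JE JM) plaqLinks ω)]
  simp only [spinOfEquiv_apply, weight_eq_gksWeight, one_mul]

/-! ### 3. Polyakov loops as spin products; Griffiths' inequalities -/

/-- A time-like holonomy in an ABELIAN group is the (unordered) product of its links:
`timeHolonomy U n (t, y) = ∏_{m < n} U((t+m, y), time)`. [folklore] -/
private theorem timeHolonomy_eq_prod_range {G : Type*} [CommGroup G] (U : Config d L₀ L G)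
    (y : Fin d → ZMod L) :
    ∀ (n : ℕ) (t : ZMod L₀), timeHolonomy U n (t, y) =
      ∏ m ∈ Finset.range n, U ((t + (m : ZMod L₀), y), none)
  | 0, t => by simp [timeHolonomy]
  | n + 1, t => by
      show U ((t, y), none) * timeHolonomy U n (FiniteTemperature.Site.shift ((t, y) : FiniteTemperature.Site d L₀ L) none) = _
      have hs : FiniteTemperature.Site.shift ((t, y) : FiniteTemperature.Site d L₀ L) none = (t + 1, y) := rfl
      rw [hs, timeHolonomy_eq_prod_range U y n (t + 1), Finset.prod_range_succ', mul_comm]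
      congr 1
      · refine Finset.prod_congr rfl fun m _ => ?_
        congr 3; push_cast; ring
      · simp

/-- Reindexing `{0,…,L₀-1} → ℤ/L₀`. [folklore] -/
private theorem prod_range_natCast [NeZero L₀] {M : Type*} [CommMonoid M] (f : ZMod L₀ → M) :
    ∏ m ∈ Finset.range L₀, f (m : ZMod L₀) = ∏ t : ZMod L₀, f t := by
  refine Finset.prod_nbij (fun m : ℕ => (m : ZMod L₀)) (fun _ _ => mem_univ _) ?_ ?_ (fun _ _ => rfl)
  · intro a ha b hb h
    have h' := congrArg ZMod.val h
    simp only at h'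
    rwa [ZMod.val_natCast_of_lt (mem_range.1 (mem_coe.1 ha)),
      ZMod.val_natCast_of_lt (mem_range.1 (mem_coe.1 hb))] at h'
  · intro t _
    exact ⟨t.val, mem_coe.2 (mem_range.2 (ZMod.val_lt t)), ZMod.natCast_zmod_val t⟩

/-- **The Polyakov loop of an abelian theory is the product of the time-like links over the time
circle**: `P_y = ∏_{t ∈ ℤ/L₀} U((t,y), time)`. [cite: BorgsSeiler1983, §II.3 Lemma II.4, Remark 1 (p. 336)] -/
theorem polyakovLine_eq_prod [NeZero L₀] {G : Type*} [CommGroup G] (U : Config d L₀ L G)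
    (y : Fin d → ZMod L) : polyakovLine U y = ∏ t : ZMod L₀, U ((t, y), none) := by
  rw [polyakovLine, timeHolonomy_eq_prod_range U y L₀ 0]
  simp only [zero_add]
  exact prod_range_natCast fun t => U ((t, y), none)

/-- The time-like links at the spatial site `y` (the support of the Polyakov loop). [folklore] -/
def timeLine [NeZero L₀] (y : Fin d → ZMod L) : Finset (Link d L₀ L) :=
  univ.image fun t : ZMod L₀ => (((t, y) : FiniteTemperature.Site d L₀ L), (none : Dir d))

/-- The `ℤ₂` Polyakov loop variable is the spin product over its time line:
`χ(P_y) = ∏_t σ_{(t,y),time}` (Chatterjee 2020 (1.3): `W_γ = ∏_{e ∈ γ} σ_e`, here for the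
periodic time line). [cite: arXiv181109770, §1.1 (1.3)] -/
theorem z2Character_polyakovLine [NeZero L₀] (U : Config d L₀ L Z2) (y : Fin d → ZMod L) :
    z2Character (polyakovLine U y) = spinProduct (timeLine y) (spinOf U) := by
  rw [polyakovLine_eq_prod, ← z2CharacterHom_apply, map_prod, timeLine, spinProduct,
    Finset.prod_image fun t₁ _ t₂ _ h => (Prod.ext_iff.1 (Prod.ext_iff.1 h).1).1]
  simp only [z2CharacterHom_apply, spinAt_spinOf]

/-- The Polyakov-loop pair observable of the `ℤ₂` theory is the spin product over the symmetric
difference of the two time lines: `Re(tr P_0 · conj tr P_x) = χ(P_0)χ(P_x) = σ_{ℓ_0 ∆ ℓ_x}`.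
[cite: BorgsSeiler1983, §II.3 (II.22) (p. 337)] -/
theorem polyakovPair_eq_spinProduct [NeZero L₀] (U : Config d L₀ L Z2) (x : Fin d → ZMod L) :
    (polyakovTrace z2Rep U 0 * starRingEnd ℂ (polyakovTrace z2Rep U x)).re =
      spinProduct (timeLine 0 ∆ timeLine x) (spinOf U) := by
  rw [polyakovTrace, polyakovTrace, trace_z2Rep, trace_z2Rep, Complex.conj_ofReal,
    ← Complex.ofReal_mul, Complex.ofReal_re, z2Character_polyakovLine, z2Character_polyakovLine,
    spinProduct_mul_eq_spinProduct_symmDiff]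

/-- **The `ℤ₂` Polyakov-loop two-point function is a GKS expectation of a spin product**:
`G_L(x) = ⟨σ_{ℓ_0 ∆ ℓ_x}⟩_{ν_K}`. [cite: BorgsSeiler1983, §II.3 (II.22) (p. 337)] -/
theorem polyakovCorrelation_eq_gksExpect [NeZero L₀] [NeZero L] (JE JM : ℝ) (x : Fin d → ZMod L) :
    polyakovCorrelation (L₀ := L₀) z2Rep JE JM x =
      gksExpect univ (cpl JE JM) plaqLinks (spinProduct (timeLine (L₀ := L₀) 0 ∆ timeLine x)) := by
  rw [polyakovCorrelation, ← expectation_eq_gksExpect]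
  congr 1
  funext U
  exact polyakovPair_eq_spinProduct U x

/-- **Griffiths I**: the `ℤ₂` Polyakov-loop two-point function is non-negative for
`J_E, J_M ≥ 0`. [cite: FriedliVelenik2017, Thm. 3.49 (3.54), p. 141] -/
theorem polyakovCorrelation_nonneg [NeZero L₀] [NeZero L] {JE JM : ℝ} (hJE : 0 ≤ JE) (hJM : 0 ≤ JM)
    (x : Fin d → ZMod L) : 0 ≤ polyakovCorrelation (L₀ := L₀) z2Rep JE JM x := by
  rw [polyakovCorrelation_eq_gksExpect]
  exact gksExpect_spinProduct_nonneg _ _ _ (fun i _ => cpl_nonneg hJE hJM i) _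

/-- **Griffiths II in the magnetic coupling** ("The random couplings might be expected to create
disorder, thereby making deconfinement harder. For abelian models this follows from Ginibre's
inequalities", Borgs–Seiler p. 358): for `0 ≤ J_E` and `0 ≤ J_M ≤ J_M'`,
`G_L(x; J_E, J_M) ≤ G_L(x; J_E, J_M')`; in particular the ultralocal model `J_M = 0` bounds every
`J_M ≥ 0` from below. [cite: BorgsSeiler1983, §IV (p. 358)] -/
theorem polyakovCorrelation_mono_magnetic [NeZero L₀] [NeZero L] {JE JM JM' : ℝ} (hJE : 0 ≤ JE)
    (hJM : 0 ≤ JM) (hJM' : JM ≤ JM') (x : Fin d → ZMod L) :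
    polyakovCorrelation (L₀ := L₀) z2Rep JE JM x ≤ polyakovCorrelation (L₀ := L₀) z2Rep JE JM' x := by
  classical
  rw [polyakovCorrelation_eq_gksExpect, polyakovCorrelation_eq_gksExpect]
  refine gksExpect_mono_of_abs_le _ _ (fun i _ => ?_) _
  rcases i with i | i
  · simp [cpl, abs_of_nonneg hJE]
  · simp [cpl, abs_of_nonneg hJM, hJM']

/-- **Griffiths II in the electric coupling**: for `0 ≤ J_M` and `0 ≤ J_E ≤ J_E'`,
`G_L(x; J_E, J_M) ≤ G_L(x; J_E', J_M)`. [cite: FriedliVelenik2017, Exercise 3.31, p. 142] -/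
theorem polyakovCorrelation_mono_electric [NeZero L₀] [NeZero L] {JE JE' JM : ℝ} (hJE : 0 ≤ JE)
    (hJE' : JE ≤ JE') (hJM : 0 ≤ JM) (x : Fin d → ZMod L) :
    polyakovCorrelation (L₀ := L₀) z2Rep JE JM x ≤ polyakovCorrelation (L₀ := L₀) z2Rep JE' JM x := by
  classical
  rw [polyakovCorrelation_eq_gksExpect, polyakovCorrelation_eq_gksExpect]
  refine gksExpect_mono_of_abs_le _ _ (fun i _ => ?_) _
  rcases i with i | i
  · simp [cpl, abs_of_nonneg hJE, hJE']
  · simp [cpl, abs_of_nonneg hJM]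


/-! ### 4. The ultralocal model `J_M = 0`: integrating out the space-like links

Borgs–Seiler p. 358: "For `J_M = 0` we obtain the "ultralocal" model … For finite temperature it
becomes structurally identical to a one time layer model … with a more complicated electric
coupling arising from the `L₀`-fold convolution". For `ℤ₂` we compute this convolution in closed
form: the space-like links of one spatial bond form, over the time circle, an Ising chain of length
`L₀` whose couplings `J_E ε_t` carry the signs `ε_t = σ_{(t,y),time} σ_{(t,y+eᵢ),time}` of the
adjacent time-like links; summing it out leaves `(2 cosh J_E)^{L₀} (1 + (tanh J_E)^{L₀} ∏_t ε_t)`,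
and `∏_t ε_t = χ(P_y) χ(P_{y+eᵢ})` is the product of the two Polyakov loops. -/

section Ultralocal

/-- **The `±1` symmetry trick**: `∑_ω σ_B(ω) = 0` for `B ≠ ∅` (flip one spin of `B`) and
`= 2^{|Λ|}` for `B = ∅`. [cite: FriedliVelenik2017, §3.7.3 (high-temperature expansion)] -/
theorem sum_spinProduct_eq {Λ : Type*} [Fintype Λ] [DecidableEq Λ] (B : Finset Λ) :
    ∑ ω : SpinConfig Λ, spinProduct B ω =
      if B = ∅ then (Fintype.card (SpinConfig Λ) : ℝ) else 0 := by
  split_ifs with hB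
  · subst hB; simp
  · obtain ⟨b, hb⟩ := Finset.nonempty_iff_ne_empty.2 hB
    set δ : SpinConfig Λ := Function.update 1 b (-1) with hδ
    have hδB : spinProduct B δ = -1 := by
      rw [spinProduct, ← Finset.mul_prod_erase _ _ hb]
      have h1 : spinAt b δ = -1 := by simp [spinAt, hδ]
      have h2 : ∏ x ∈ B.erase b, spinAt x δ = 1 := Finset.prod_eq_one fun x hx => by
        simp [spinAt, hδ, Function.update_of_ne (Finset.ne_of_mem_erase hx)]
      rw [h1, h2]; norm_num
    have h : ∑ ω : SpinConfig Λ, spinProduct B (ω * δ) = ∑ ω : SpinConfig Λ, spinProduct B ω :=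
      Fintype.sum_equiv (Equiv.mulRight δ) _ _ fun _ => rfl
    simp only [spinProduct_mul_cfg, hδB, mul_neg, mul_one, Finset.sum_neg_distrib] at h
    linarith

/-- A subset of the cycle `ℤ/L₀` invariant under `t ↦ t + 1` is empty or everything. [folklore] -/
private theorem image_add_one_eq_self_iff [NeZero L₀] (A : Finset (ZMod L₀)) :
    A.image (· + 1) = A ↔ A = ∅ ∨ A = univ := by
  constructor
  · intro h
    rcases A.eq_empty_or_nonempty with hA | ⟨a, ha⟩
    · exact Or.inl hA
    · refine Or.inr (Finset.eq_univ_of_forall fun t => ?_)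
      have step : ∀ s ∈ A, s + 1 ∈ A := fun s hs => by
        rw [← h]; exact Finset.mem_image_of_mem _ hs
      have hn : ∀ n : ℕ, a + n ∈ A := by
        intro n
        induction n with
        | zero => simpa using ha
        | succ n ih =>
            have := step _ ih
            push_cast
            rwa [← add_assoc]
      have := hn (t - a).val
      rwa [ZMod.natCast_zmod_val, add_sub_cancel] at this
  · rintro (rfl | rfl)
    · simp
    · exact Finset.image_univ_of_surjective fun t => ⟨t - 1, sub_add_cancel t 1⟩

/-- `e^{Ju} = cosh J · (1 + u tanh J)` for `u = ±1`. [folklore] -/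
private theorem exp_mul_eq_cosh_mul (J : ℝ) {u : ℝ} (hu : u = 1 ∨ u = -1) :
    Real.exp (J * u) = Real.cosh J * (1 + Real.tanh J * u) := by
  rw [exp_mul_eq_cosh_add_mul_sinh J hu, Real.tanh_eq_sinh_div_cosh]
  field_simp [(Real.cosh_pos J).ne']

/-- **The `ℤ₂` chain of length `L₀` closed by the Polyakov loops** (high-temperature expansion on
the cycle `ℤ/L₀`: only the empty and the full edge sets have no odd vertex):
`∑_{s : ℤ/L₀ → ℤ₂} ∏_t e^{J ε_t χ(s_{t+1}) χ(s_t)} = (2 cosh J)^{L₀} (1 + (tanh J)^{L₀} ∏_t ε_t)` for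
signs `ε_t = ±1` — the `L₀`-fold convolution of the `ℤ₂` electric weight `cosh J + χ sinh J`.
[cite: BorgsSeiler1983, §IV (p. 358)] -/
theorem chainSum_eq [NeZero L₀] (J : ℝ) (ε : ZMod L₀ → ℝ) (hε : ∀ t, ε t = 1 ∨ ε t = -1) :
    ∑ s : ZMod L₀ → Z2, ∏ t : ZMod L₀,
        Real.exp (J * (ε t * (z2Character (s (t + 1)) * z2Character (s t)))) =
      (2 * Real.cosh J) ^ L₀ * (1 + Real.tanh J ^ L₀ * ∏ t : ZMod L₀, ε t) := by
  classical
  -- pass to `±1` spin configurations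
  have hconv : ∑ s : ZMod L₀ → Z2, ∏ t : ZMod L₀,
        Real.exp (J * (ε t * (z2Character (s (t + 1)) * z2Character (s t)))) =
      ∑ σ : SpinConfig (ZMod L₀), ∏ t : ZMod L₀,
        Real.exp (J * (ε t * (spinAt (t + 1) σ * spinAt t σ))) := by
    refine Fintype.sum_equiv (Equiv.piCongrRight fun _ : ZMod L₀ => z2UnitEquiv) _ _ fun s => ?_
    refine Finset.prod_congr rfl fun t _ => ?_
    simp only [Equiv.piCongrRight_apply, spinAt, Pi.map_apply]
    rw [show (z2UnitEquiv (s (t + 1)) : ℤˣ) = z2Spin (s (t + 1)) from rfl,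
      show (z2UnitEquiv (s t) : ℤˣ) = z2Spin (s t) from rfl, cast_z2Spin, cast_z2Spin]
  rw [hconv]
  -- `e^{J u} = cosh J (1 + tanh J · u)` termwise, and expand the product
  have hterm : ∀ (σ : SpinConfig (ZMod L₀)),
      ∏ t : ZMod L₀, Real.exp (J * (ε t * (spinAt (t + 1) σ * spinAt t σ))) =
        Real.cosh J ^ L₀ * ∑ A ∈ (univ : Finset (ZMod L₀)).powerset,
          (Real.tanh J ^ #A * ∏ t ∈ A, ε t) * spinProduct (A.image (· + 1) ∆ A) σ := by
    intro σ
    have hu : ∀ t, ε t * (spinAt (t + 1) σ * spinAt t σ) = 1 ∨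
        ε t * (spinAt (t + 1) σ * spinAt t σ) = -1 := by
      intro t
      rcases hε t with h | h <;> rcases spinAt_eq_one_or_eq_neg_one (t + 1) σ with h₁ | h₁ <;>
        rcases spinAt_eq_one_or_eq_neg_one t σ with h₂ | h₂ <;> simp [h, h₁, h₂]
    simp_rw [fun t => exp_mul_eq_cosh_mul J (hu t)]
    rw [Finset.prod_mul_distrib, Finset.prod_const, Finset.card_univ, ZMod.card, Finset.prod_one_add]
    congr 1
    refine Finset.sum_congr rfl fun A _ => ?_
    rw [← spinProduct_mul_eq_spinProduct_symmDiff, spinProduct, spinProduct,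
      Finset.prod_image fun t₁ _ t₂ _ h => add_right_cancel h]
    simp_rw [mul_comm (ε _) _, ← mul_assoc (Real.tanh J)]
    rw [Finset.prod_mul_distrib, Finset.prod_mul_distrib, Finset.prod_mul_distrib, Finset.prod_const]
    ring
  simp_rw [hterm]
  rw [← Finset.mul_sum, Finset.sum_comm]
  simp_rw [← Finset.mul_sum, sum_spinProduct_eq, Finset.symmDiff_eq_empty, image_add_one_eq_self_iff]
  -- only `A = ∅` and `A = univ` survive
  have hne : (∅ : Finset (ZMod L₀)) ≠ univ := Finset.univ_nonempty.ne_empty.symm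
  rw [Finset.sum_eq_add_of_mem (∅ : Finset (ZMod L₀)) univ (Finset.empty_mem_powerset _)
    (Finset.mem_powerset.2 subset_rfl) hne fun A _ hA => by simp [hA.1, hA.2]]
  simp [hne, hne.symm, mul_pow]
  ring

/-! #### Time-like and space-like parts of a configuration -/

variable {G : Type*}

/-- Glue a time-like field `T` (on the sites: the link `(x, time)`) and a space-like field `S`
(on `(x, i)`: the link `(x, eᵢ)`) into a configuration. [folklore] -/
def glue (T : FiniteTemperature.Site d L₀ L → G) (S : FiniteTemperature.Site d L₀ L × Fin d → G) :
    Config d L₀ L G :=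
  fun e => Option.elim e.2 (T e.1) fun i => S (e.1, i)

/-- `glue` on a time-like link. [folklore] -/
@[simp] private theorem glue_none (T : FiniteTemperature.Site d L₀ L → G)
    (S : FiniteTemperature.Site d L₀ L × Fin d → G) (x : FiniteTemperature.Site d L₀ L) :
    glue T S (x, none) = T x := rfl

/-- `glue` on a space-like link. [folklore] -/
@[simp] private theorem glue_some (T : FiniteTemperature.Site d L₀ L → G)
    (S : FiniteTemperature.Site d L₀ L × Fin d → G) (x : FiniteTemperature.Site d L₀ L) (i : Fin d) :
    glue T S (x, some i) = S (x, i) := rfl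

/-- Configurations `≃` (time-like part, space-like part). [folklore] -/
def splitEquiv : Config d L₀ L G ≃
    (FiniteTemperature.Site d L₀ L → G) × (FiniteTemperature.Site d L₀ L × Fin d → G) where
  toFun U := (fun x => U (x, none), fun q => U (q.1, some q.2))
  invFun TS := glue TS.1 TS.2
  left_inv U := by
    funext ⟨x, μ⟩
    cases μ <;> rfl
  right_inv _ := rfl

/-- **Fubini for the finite sum**: `∑_U Φ(U) = ∑_T ∑_S Φ(glue T S)`. [folklore] -/
private theorem sum_config_eq_sum_sum [NeZero L₀] [NeZero L] [Fintype G] {M : Type*} [AddCommMonoid M] (Φ : Config d L₀ L G → M) :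
    ∑ U : Config d L₀ L G, Φ U = ∑ T : FiniteTemperature.Site d L₀ L → G,
      ∑ S : FiniteTemperature.Site d L₀ L × Fin d → G, Φ (glue T S) := by
  rw [← (splitEquiv (d := d) (L₀ := L₀) (L := L) (G := G)).symm.sum_comp Φ, Fintype.sum_prod_type]
  rfl

/-- The Polyakov loops of the time-like field: `P_y(T) = ∏_t T(t, y)` (abelian `G`). [folklore] -/
def loopOf [NeZero L₀] [CommGroup G] (T : FiniteTemperature.Site d L₀ L → G) (y : Fin d → ZMod L) : G :=
  ∏ t : ZMod L₀, T (t, y)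

/-- The Polyakov loop of a glued configuration is the loop of its time-like part. [folklore] -/
private theorem polyakovLine_glue [NeZero L₀] [CommGroup G] (T : FiniteTemperature.Site d L₀ L → G)
    (S : FiniteTemperature.Site d L₀ L × Fin d → G) (y : Fin d → ZMod L) :
    polyakovLine (glue T S) y = loopOf T y := by
  rw [polyakovLine_eq_prod]; rfl

/-- `T ↦ P(T)` is a homomorphism. [folklore] -/
private theorem loopOf_mul [NeZero L₀] [CommGroup G] (T T' : FiniteTemperature.Site d L₀ L → G) :
    loopOf (T * T') = loopOf T * loopOf T' := by
  funext y
  simp [loopOf, Finset.prod_mul_distrib]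

/-- `T ↦ P(T)` is a homomorphism (division). [folklore] -/
private theorem loopOf_div [NeZero L₀] [CommGroup G] (T T' : FiniteTemperature.Site d L₀ L → G) :
    loopOf (T / T') = loopOf T / loopOf T' := by
  funext y
  simp [loopOf, Finset.prod_div_distrib]

/-- `T ↦ P(T)` is onto: put the prescribed loop on the time-`0` links. [folklore] -/
private theorem loopOf_surjective [NeZero L₀] [CommGroup G] :
    Function.Surjective (loopOf : (FiniteTemperature.Site d L₀ L → G) → (Fin d → ZMod L) → G) := by
  classical
  intro P
  refine ⟨fun x => if x.1 = 0 then P x.2 else 1, funext fun y => ?_⟩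
  simp [loopOf, Finset.prod_ite_eq']

/-- All fibres of `T ↦ P(T)` have the cardinality of its kernel. [folklore] -/
private theorem card_filter_loopOf_eq [NeZero L₀] [NeZero L] [CommGroup G] [Fintype G] [DecidableEq G]
    (T₀ : FiniteTemperature.Site d L₀ L → G) :
    #(univ.filter fun T : FiniteTemperature.Site d L₀ L → G => loopOf T = loopOf T₀) =
      #(univ.filter fun T : FiniteTemperature.Site d L₀ L → G => loopOf T = 1) := by
  refine Finset.card_nbij' (fun T => T / T₀) (fun T => T * T₀) ?_ ?_ (fun T _ => by simp)
    (fun T _ => by simp)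
  · intro T hT
    simp only [Finset.coe_filter, Finset.mem_univ, true_and, Set.mem_setOf_eq] at hT ⊢
    rw [loopOf_div, hT, div_self']
  · intro T hT
    simp only [Finset.coe_filter, Finset.mem_univ, true_and, Set.mem_setOf_eq] at hT ⊢
    rw [loopOf_mul, hT, one_mul]

/-- **Push-forward of the uniform measure of the time-like links to the Polyakov loops**:
`∑_T Ψ(P(T)) = #ker · ∑_P Ψ(P)` (a surjective homomorphism of finite abelian groups has
equicardinal fibres). [folklore] -/
private theorem sum_comp_loopOf [NeZero L₀] [NeZero L] [CommGroup G] [Fintype G] [DecidableEq G] {M : Type*}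
    [AddCommMonoid M] (Ψ : ((Fin d → ZMod L) → G) → M) :
    ∑ T : FiniteTemperature.Site d L₀ L → G, Ψ (loopOf T) =
      #(univ.filter fun T : FiniteTemperature.Site d L₀ L → G => loopOf T = 1) •
        ∑ P : (Fin d → ZMod L) → G, Ψ P := by
  rw [Finset.sum_comp, Finset.image_univ_of_surjective loopOf_surjective, Finset.smul_sum]
  refine Finset.sum_congr rfl fun P _ => ?_
  obtain ⟨T₀, rfl⟩ := loopOf_surjective (d := d) (L₀ := L₀) (L := L) (G := G) P
  rw [card_filter_loopOf_eq T₀]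

/-- The trivial time-like field has trivial loops. [folklore] -/
private theorem loopOf_one [NeZero L₀] [CommGroup G] :
    loopOf (1 : FiniteTemperature.Site d L₀ L → G) = (1 : (Fin d → ZMod L) → G) := by
  funext y
  simp [loopOf]

/-- The multiplicity `#ker` is positive. [folklore] -/
private theorem card_filter_loopOf_one_pos [NeZero L₀] [NeZero L] [CommGroup G] [Fintype G] [DecidableEq G] :
    0 < #(univ.filter fun T : FiniteTemperature.Site d L₀ L → G => loopOf T = 1) :=
  Finset.card_pos.2 ⟨1, Finset.mem_filter.2 ⟨Finset.mem_univ _, loopOf_one⟩⟩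

/-! #### The electric weight of a glued configuration and the sum over the space-like links -/

/-- Reindexing `(sites × directions) ≃ (spatial bonds × times)`: `((t,y),i) ↦ ((y,i),t)`. [folklore] -/
def bondTimeEquiv : FiniteTemperature.Site d L₀ L × Fin d ≃ ((Fin d → ZMod L) × Fin d) × ZMod L₀ where
  toFun p := ((p.1.2, p.2), p.1.1)
  invFun q := ((q.2, q.1.1), q.1.2)
  left_inv _ := rfl
  right_inv _ := rfl

/-- Space-like fields `≃` families of time-chains indexed by the spatial bonds. [folklore] -/
def chainsEquiv : (FiniteTemperature.Site d L₀ L × Fin d → G) ≃ (((Fin d → ZMod L) × Fin d) → ZMod L₀ → G) :=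
  (bondTimeEquiv.arrowCongr (Equiv.refl G)).trans (Equiv.curry _ _ _)

/-- `chainsEquiv S (y,i) t = S((t,y),i)`. [folklore] -/
@[simp] private theorem chainsEquiv_apply (S : FiniteTemperature.Site d L₀ L × Fin d → G)
    (q : (Fin d → ZMod L) × Fin d) (t : ZMod L₀) : chainsEquiv S q t = S ((t, q.1), q.2) := rfl

/-- The sign carried by the time-like links of the time-like plaquette at `(x; time, i)`:
`ε_T(x,i) = χ(T(x)) χ(T(x + eᵢ))`. [folklore] -/
def tsign (T : FiniteTemperature.Site d L₀ L → Z2) (x : FiniteTemperature.Site d L₀ L) (i : Fin d) : ℝ :=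
  z2Character (T x) * z2Character (T (x.shift (some i)))

/-- `χ = ±1` on `ℤ₂`. [folklore] -/
private theorem z2Character_eq_one_or_neg_one (a : Z2) : z2Character a = 1 ∨ z2Character a = -1 := by
  rw [← cast_z2Spin]
  rcases Int.units_eq_one_or (z2Spin a) with h | h <;> simp [h]

/-- `ε = ±1`. [folklore] -/
private theorem tsign_eq_one_or (T : FiniteTemperature.Site d L₀ L → Z2) (x : FiniteTemperature.Site d L₀ L)
    (i : Fin d) : tsign T x i = 1 ∨ tsign T x i = -1 := by
  unfold tsign
  rcases z2Character_eq_one_or_neg_one (T x) with h | h <;>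
    rcases z2Character_eq_one_or_neg_one (T (x.shift (some i))) with h' | h' <;> simp [h, h']

/-- The character of a time-like plaquette of a glued `ℤ₂` configuration:
`χ(U_P) = ε_T(x,i) · χ(S(x + e_time, i)) χ(S(x, i))`. [folklore] -/
private theorem z2Character_plaquette_glue (T : FiniteTemperature.Site d L₀ L → Z2)
    (S : FiniteTemperature.Site d L₀ L × Fin d → Z2) (x : FiniteTemperature.Site d L₀ L) (i : Fin d) :
    z2Character (plaquette (glue T S) x none (some i)) =
      tsign T x i * (z2Character (S (x.shift none, i)) * z2Character (S (x, i))) := by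
  rw [plaquette, z2Character_mul, z2Character_mul, z2Character_mul, z2Character_inv, z2Character_inv,
    glue_none, glue_some, glue_none, glue_some, tsign]
  ring

/-- **The electric weight of a glued configuration factorises over the spatial bonds into time
chains**: `e^{J_E ∑_{P time-like} χ(U_P)} = ∏_{(y,i)} ∏_t e^{J_E ε_T((t,y),i) χ(S((t+1,y),i)) χ(S((t,y),i))}`. [folklore] -/
private theorem weight_glue_eq_prod [NeZero L₀] [NeZero L] (JE : ℝ) (T : FiniteTemperature.Site d L₀ L → Z2)
    (S : FiniteTemperature.Site d L₀ L × Fin d → Z2) :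
    weight z2Rep JE 0 (glue T S) =
      ∏ q : (Fin d → ZMod L) × Fin d, ∏ t : ZMod L₀,
        Real.exp (JE * (tsign T (t, q.1) q.2 *
          (z2Character (chainsEquiv S q (t + 1)) * z2Character (chainsEquiv S q t)))) := by
  rw [weight, minusAction, zero_mul, add_zero]
  simp_rw [trace_z2Rep_re, z2Character_plaquette_glue, chainsEquiv_apply]
  rw [Finset.mul_sum]
  simp_rw [Finset.mul_sum]
  rw [← Fintype.sum_prod_type', ← bondTimeEquiv.symm.sum_comp, Fintype.sum_prod_type, Real.exp_sum]
  refine Finset.prod_congr rfl fun q _ => ?_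
  rw [Real.exp_sum]
  rfl

/-- **Summing out the space-like links of the ultralocal model**:
`∑_S e^{-S_E(glue T S)} = ∏_{(y,i)} (2 cosh J_E)^{L₀} (1 + (tanh J_E)^{L₀} χ(P_y(T)) χ(P_{y+eᵢ}(T)))` —
the one-layer model of the Polyakov loops with the `L₀`-fold convolved coupling.
[cite: BorgsSeiler1983, §IV (p. 358)] -/
theorem sum_weight_glue [NeZero L₀] [NeZero L] (JE : ℝ) (T : FiniteTemperature.Site d L₀ L → Z2) :
    ∑ S : FiniteTemperature.Site d L₀ L × Fin d → Z2, weight z2Rep JE 0 (glue T S) =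
      ∏ q : (Fin d → ZMod L) × Fin d, (2 * Real.cosh JE) ^ L₀ *
        (1 + Real.tanh JE ^ L₀ *
          (z2Character (loopOf T q.1) * z2Character (loopOf T (q.1 + Pi.single q.2 1)))) := by
  classical
  simp_rw [weight_glue_eq_prod]
  rw [← (chainsEquiv (d := d) (L₀ := L₀) (L := L) (G := Z2)).symm.sum_comp]
  simp_rw [Equiv.apply_symm_apply]
  rw [← Fintype.prod_sum fun (q : (Fin d → ZMod L) × Fin d) (s : ZMod L₀ → Z2) => ∏ t : ZMod L₀,
    Real.exp (JE * (tsign T (t, q.1) q.2 * (z2Character (s (t + 1)) * z2Character (s t))))]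
  refine Finset.prod_congr rfl fun q _ => ?_
  rw [chainSum_eq JE (fun t => tsign T (t, q.1) q.2) fun t => tsign_eq_one_or T _ _]
  congr 2
  simp only [tsign, loopOf, ← z2CharacterHom_apply, map_prod, Finset.prod_mul_distrib]
  rfl

/-! #### The Polyakov correlation of the ultralocal model as an average over the loops -/

/-- The one-layer Boltzmann factor of the Polyakov loops `P : (ℤ/L)^d → ℤ₂` at "activity" `a`:
`∏_{(y,i)} (1 + a χ(P_y) χ(P_{y+eᵢ}))`. [cite: BorgsSeiler1983, §IV (p. 358)] -/
def loopWeight [NeZero L] (a : ℝ) (P : (Fin d → ZMod L) → Z2) : ℝ :=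
  ∏ q : (Fin d → ZMod L) × Fin d, (1 + a * (z2Character (P q.1) * z2Character (P (q.1 + Pi.single q.2 1))))

/-- **The ultralocal Polyakov two-point function is a one-layer average over the loops**:
`G_L(x; J_E, 0) = ∑_P χ(P_0)χ(P_x) w_a(P) / ∑_P w_a(P)`, `a = (tanh J_E)^{L₀}`.
[cite: BorgsSeiler1983, §IV (p. 358)] -/
theorem polyakovCorrelation_ultralocal_eq_loopAverage [NeZero L₀] [NeZero L] (JE : ℝ)
    (x : Fin d → ZMod L) :
    polyakovCorrelation (L₀ := L₀) z2Rep JE 0 x =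
      (∑ P : (Fin d → ZMod L) → Z2, z2Character (P 0) * z2Character (P x) *
          loopWeight (Real.tanh JE ^ L₀) P) /
        ∑ P : (Fin d → ZMod L) → Z2, loopWeight (Real.tanh JE ^ L₀) P := by
  classical
  rw [polyakovCorrelation, expectation_eq_sum_div]
  -- the observable is a function of the Polyakov loops
  have hobs : ∀ U : Config d L₀ L Z2,
      (polyakovTrace z2Rep U 0 * starRingEnd ℂ (polyakovTrace z2Rep U x)).re =
        z2Character (polyakovLine U 0) * z2Character (polyakovLine U x) := by
    intro U
    rw [polyakovTrace, polyakovTrace, trace_z2Rep, trace_z2Rep, Complex.conj_ofReal,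
      ← Complex.ofReal_mul, Complex.ofReal_re]
  simp_rw [hobs]
  -- Fubini, sum out the space-like links, push forward to the loops
  set C : ℝ := ((2 * Real.cosh JE) ^ L₀) ^ Fintype.card ((Fin d → ZMod L) × Fin d) with hC
  have hS : ∀ T : FiniteTemperature.Site d L₀ L → Z2,
      ∑ S : FiniteTemperature.Site d L₀ L × Fin d → Z2, weight z2Rep JE 0 (glue T S) =
        C * loopWeight (Real.tanh JE ^ L₀) (loopOf T) := by
    intro T
    rw [sum_weight_glue, loopWeight, hC, ← Finset.card_univ, ← Finset.prod_const, ← Finset.prod_mul_distrib]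
  have hnum : ∑ U : Config d L₀ L Z2, z2Character (polyakovLine U 0) * z2Character (polyakovLine U x) *
        weight z2Rep JE 0 U =
      #(univ.filter fun T : FiniteTemperature.Site d L₀ L → Z2 => loopOf T = 1) •
        ∑ P : (Fin d → ZMod L) → Z2, C * (z2Character (P 0) * z2Character (P x) *
          loopWeight (Real.tanh JE ^ L₀) P) := by
    rw [sum_config_eq_sum_sum, ← sum_comp_loopOf]
    refine Finset.sum_congr rfl fun T _ => ?_
    simp_rw [polyakovLine_glue]
    rw [← Finset.mul_sum, hS]
    ring
  have hden : ∑ U : Config d L₀ L Z2, weight z2Rep JE 0 U =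
      #(univ.filter fun T : FiniteTemperature.Site d L₀ L → Z2 => loopOf T = 1) •
        ∑ P : (Fin d → ZMod L) → Z2, C * loopWeight (Real.tanh JE ^ L₀) P := by
    rw [sum_config_eq_sum_sum, ← sum_comp_loopOf]
    exact Finset.sum_congr rfl fun T _ => hS T
  rw [hnum, hden, nsmul_eq_mul, nsmul_eq_mul, ← Finset.mul_sum, ← Finset.mul_sum]
  have hk : (0 : ℝ) < #(univ.filter fun T : FiniteTemperature.Site d L₀ L → Z2 => loopOf T = 1) := by
    exact_mod_cast card_filter_loopOf_one_pos (d := d) (L₀ := L₀) (L := L) (G := Z2)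
  have hC0 : 0 < C := by rw [hC]; exact pow_pos (pow_pos (by positivity) _) _
  rw [mul_div_mul_left _ _ hk.ne', mul_div_mul_left _ _ hC0.ne']

end Ultralocal


/-! ### 5. The one-layer model of the loops is the Ising model at `K = artanh((tanh J_E)^{L₀})` -/

section Ising

/-- **The effective Ising coupling of the Polyakov loops**: `K(J_E, L₀) = artanh((tanh J_E)^{L₀})`,
i.e. `tanh K = (tanh J_E)^{L₀}` — the `L₀`-fold convolution of the `ℤ₂` electric weight
`cosh J_E (1 + χ tanh J_E)` is `∝ 1 + χ (tanh J_E)^{L₀} ∝ e^{K χ}`. [cite: BorgsSeiler1983, §IV (p. 358)] -/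
def effCoupling (JE : ℝ) (L₀ : ℕ) : ℝ := Real.artanh (Real.tanh JE ^ L₀)

/-- `|(tanh J_E)^{L₀}| < 1` for `L₀ ≥ 1`. [folklore] -/
private theorem abs_tanh_pow_lt_one [NeZero L₀] (JE : ℝ) : |Real.tanh JE ^ L₀| < 1 := by
  rw [abs_pow]
  exact pow_lt_one₀ (abs_nonneg _) (Real.abs_tanh_lt_one JE) (NeZero.ne L₀)

/-- `(tanh J_E)^{L₀} ∈ (-1, 1)`. [folklore] -/
private theorem tanh_pow_mem_Ioo [NeZero L₀] (JE : ℝ) : Real.tanh JE ^ L₀ ∈ Set.Ioo (-1 : ℝ) 1 :=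
  abs_lt.1 (abs_tanh_pow_lt_one JE)

/-- `tanh K(J_E, L₀) = (tanh J_E)^{L₀}`: the defining property of the effective coupling of the
`L₀`-fold convolved electric weight. [cite: BorgsSeiler1983, §IV (p. 358)] -/
theorem tanh_effCoupling [NeZero L₀] (JE : ℝ) :
    Real.tanh (effCoupling JE L₀) = Real.tanh JE ^ L₀ :=
  Real.tanh_artanh (tanh_pow_mem_Ioo JE)

/-- `tanh x > 0` for `x > 0`. [folklore] -/
private theorem tanh_pos_of_pos {x : ℝ} (hx : 0 < x) : 0 < Real.tanh x := by
  rw [Real.tanh_eq_sinh_div_cosh]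
  exact div_pos (Real.sinh_pos_iff.2 hx) (Real.cosh_pos x)

/-- `tanh x ≥ 0` for `x ≥ 0`. [folklore] -/
private theorem tanh_nonneg_of_nonneg {x : ℝ} (hx : 0 ≤ x) : 0 ≤ Real.tanh x := by
  rw [Real.tanh_eq_sinh_div_cosh]
  exact div_nonneg (Real.sinh_nonneg_iff.2 hx) (Real.cosh_pos x).le

/-- `K(J_E, L₀) > 0` for `J_E > 0` (the effective coupling is ferromagnetic). [cite: BorgsSeiler1983, §IV (p. 358)] -/
theorem effCoupling_pos [NeZero L₀] {JE : ℝ} (hJE : 0 < JE) : 0 < effCoupling JE L₀ :=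
  Real.artanh_pos ⟨pow_pos (tanh_pos_of_pos hJE) _, (tanh_pow_mem_Ioo JE).2⟩

/-- `1 + tanh K · u = e^{Ku} / cosh K` for `u = ±1`. [folklore] -/
private theorem one_add_tanh_mul (K : ℝ) {u : ℝ} (hu : u = 1 ∨ u = -1) :
    1 + Real.tanh K * u = Real.exp (K * u) / Real.cosh K := by
  rw [exp_mul_eq_cosh_mul K hu, mul_div_cancel_left₀ _ (Real.cosh_pos K).ne']

/-- At activity `a = tanh K` the one-layer weight is the Ising Boltzmann factor of the loops:
`∏_{(y,i)} (1 + tanh K χ(P_y)χ(P_{y+eᵢ})) = (cosh K)^{-#bonds} exp(K ∑_{(y,i)} χ(P_y)χ(P_{y+eᵢ}))`. [folklore] -/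
private theorem loopWeight_tanh [NeZero L] (K : ℝ) (P : (Fin d → ZMod L) → Z2) :
    loopWeight (Real.tanh K) P =
      (Real.cosh K ^ Fintype.card ((Fin d → ZMod L) × Fin d))⁻¹ *
        Real.exp (K * ∑ q : (Fin d → ZMod L) × Fin d,
          z2Character (P q.1) * z2Character (P (q.1 + Pi.single q.2 1))) := by
  rw [loopWeight]
  have hu : ∀ q : (Fin d → ZMod L) × Fin d,
      z2Character (P q.1) * z2Character (P (q.1 + Pi.single q.2 1)) = 1 ∨
        z2Character (P q.1) * z2Character (P (q.1 + Pi.single q.2 1)) = -1 := by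
    intro q
    rcases z2Character_eq_one_or_neg_one (P q.1) with h | h <;>
      rcases z2Character_eq_one_or_neg_one (P (q.1 + Pi.single q.2 1)) with h' | h' <;> simp [h, h']
  simp_rw [fun q => one_add_tanh_mul K (hu q)]
  rw [Finset.prod_div_distrib, Finset.prod_const, Finset.card_univ, ← Real.exp_sum, ← Finset.mul_sum,
    div_eq_inv_mul]

/-- Loop configurations `P : (ℤ/L)^d → ℤ₂` as `±1` spin configurations on the spatial torus. [folklore] -/
def loopSpinEquiv : ((Fin d → ZMod L) → Z2) ≃ SpinConfig (TorusSite d L) :=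
  Equiv.piCongrRight fun _ => z2UnitEquiv

/-- The spin of a loop configuration is the character of the loop. [folklore] -/
@[simp] private theorem spinAt_loopSpinEquiv (P : (Fin d → ZMod L) → Z2) (y : TorusSite d L) :
    spinAt y (loopSpinEquiv P) = z2Character (P y) :=
  cast_z2Spin (P y)

/-- The bond sum of the one-layer model is the Ising bond sum of the spatial torus (each
nearest-neighbour bond `{y, y + eᵢ}` once; `L ≥ 3`). [cite: FriedliVelenik2017, §10.5.3] -/
theorem sum_bonds_eq_sum_edgeFinset [NeZero L] (hL : 3 ≤ L) (σ : SpinConfig (TorusSite d L)) :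
    ∑ q : (Fin d → ZMod L) × Fin d, spinAt q.1 σ * spinAt (q.1 + Pi.single q.2 1) σ =
      ∑ e ∈ (torusGraph d L).edgeFinset, bondSpin σ e := by
  rw [sum_edgeFinset_torusGraph hL, Fintype.sum_prod_type]
  simp only [bondSpin_mk]

/-- **The one-layer average over the loops is the Ising two-point function on the spatial torus**:
`∑_P χ(P_0)χ(P_x) w_{tanh K}(P) / ∑_P w_{tanh K}(P) = ⟨σ_0 σ_x⟩^{Ising}_{(ℤ/L)^d, K}` (`L ≥ 3`).
[cite: FriedliVelenik2017, §3.1, eq. (3.8)] -/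
theorem loopAverage_eq_isingTorus [NeZero L] (hL : 3 ≤ L) (K : ℝ) (x : Fin d → ZMod L) :
    (∑ P : (Fin d → ZMod L) → Z2, z2Character (P 0) * z2Character (P x) * loopWeight (Real.tanh K) P) /
        ∑ P : (Fin d → ZMod L) → Z2, loopWeight (Real.tanh K) P =
      torusTwoPoint (isingTorusMeasure d L K 0) x := by
  have hR : torusTwoPoint (isingTorusMeasure d L K 0) x =
      isingExpect (torusGraph d L) univ K 0 .free (spinPair 0 x) := rfl
  rw [hR, PairIsing.isingExpect_univ_free_eq_sum_div]
  set c : ℝ := (Real.cosh K ^ Fintype.card ((Fin d → ZMod L) × Fin d))⁻¹ with hc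
  have hc0 : c ≠ 0 := by rw [hc]; exact inv_ne_zero (pow_ne_zero _ (Real.cosh_pos K).ne')
  have hnum : ∑ P : (Fin d → ZMod L) → Z2,
        z2Character (P 0) * z2Character (P x) * loopWeight (Real.tanh K) P =
      c * ∑ σ : SpinConfig (TorusSite d L),
        spinPair 0 x σ * Real.exp (K * ∑ e ∈ (torusGraph d L).edgeFinset, bondSpin σ e) := by
    rw [Finset.mul_sum]
    refine Fintype.sum_equiv loopSpinEquiv _ _ fun P => ?_
    rw [loopWeight_tanh, ← sum_bonds_eq_sum_edgeFinset hL, spinPair]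
    simp only [spinAt_loopSpinEquiv]
    ring
  have hden : ∑ P : (Fin d → ZMod L) → Z2, loopWeight (Real.tanh K) P =
      c * ∑ σ : SpinConfig (TorusSite d L),
        Real.exp (K * ∑ e ∈ (torusGraph d L).edgeFinset, bondSpin σ e) := by
    rw [Finset.mul_sum]
    refine Fintype.sum_equiv loopSpinEquiv _ _ fun P => ?_
    rw [loopWeight_tanh, ← sum_bonds_eq_sum_edgeFinset hL]
    simp only [spinAt_loopSpinEquiv, hc]
  rw [hnum, hden, mul_div_mul_left _ _ hc0]

/-- **The ultralocal `ℤ₂` gauge theory at temporal extent `L₀` IS the Ising model of its Polyakov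
loops**: for `J_M = 0`, every `L₀ ≥ 1` and every spatial torus `(ℤ/L)^d` with `L ≥ 3`,
`G_L(x; J_E, 0) = ⟨σ_0 σ_x⟩^{Ising}_{(ℤ/L)^d, K(J_E,L₀)}`, `tanh K(J_E,L₀) = (tanh J_E)^{L₀}`
(Borgs–Seiler: the ultralocal model "becomes structurally identical to a one time layer model …
with a more complicated electric coupling arising from the `L₀`-fold convolution").
[cite: BorgsSeiler1983, §IV (p. 358)] -/
theorem polyakovCorrelation_ultralocal_eq_isingTorus [NeZero L₀] [NeZero L] (hL : 3 ≤ L) (JE : ℝ)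
    (x : Fin d → ZMod L) :
    polyakovCorrelation (L₀ := L₀) z2Rep JE 0 x =
      torusTwoPoint (isingTorusMeasure d L (effCoupling JE L₀) 0) x := by
  rw [polyakovCorrelation_ultralocal_eq_loopAverage, ← loopAverage_eq_isingTorus hL, tanh_effCoupling]

/-- **The Ising model of the Polyakov loops bounds the `ℤ₂` gauge theory from below**
("the random couplings … making deconfinement harder. For abelian models this follows from
Ginibre's inequalities", Borgs–Seiler p. 358): for `J_E, J_M ≥ 0`, `L ≥ 3`, every `L₀ ≥ 1`,
`⟨σ_0 σ_x⟩^{Ising}_{(ℤ/L)^d, K(J_E,L₀)} ≤ G_L(x; J_E, J_M)`. [cite: BorgsSeiler1983, §IV (pp. 358–359)] -/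
theorem isingTorus_le_polyakovCorrelation [NeZero L₀] [NeZero L] (hL : 3 ≤ L) {JE JM : ℝ}
    (hJE : 0 ≤ JE) (hJM : 0 ≤ JM) (x : Fin d → ZMod L) :
    torusTwoPoint (isingTorusMeasure d L (effCoupling JE L₀) 0) x ≤
      polyakovCorrelation (L₀ := L₀) z2Rep JE JM x := by
  rw [← polyakovCorrelation_ultralocal_eq_isingTorus hL JE x]
  exact polyakovCorrelation_mono_magnetic hJE le_rfl hJM x

end Ising

/-! ### 6. Long-range order of the Polyakov loops: deconfinement at every temporal extent -/

section LongRangeOrder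

/-- **Long-range order by comparison with an infrared-bounded minorant** (the tree's
Fröhlich–Simon–Spencer / Borgs–Seiler mechanism `not_tendsto_zero_of_infraredBound`, comparison
form): let `d ≥ 3` and let `G_n ≥ I_n` pointwise on the even tori `(ℤ/L_n)^d`, `L_n = 2φ(n)+2 → ∞`,
where eventually `Re Î_n ≥ 0`, `I_n(0) ≥ g₀` and `ε(p_k) Re Î_n(k) ≤ B` for `k ≠ 0`; if
`B · latticeGreen 0 < g₀`, no pointwise limit `G∞` of `G_n(x mod L_n)` tends to `0` at infinity
(block averages of `G∞` dominate those of the minorants, which stay `≥ (g₀ - B·latticeGreen 0)/2 > 0`,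
`sq_mul_le_blockSum`; a kernel decaying at infinity has vanishing block averages,
`tendsto_blockAverage_of_tendsto_cofinite`). [cite: BorgsSeiler1983, §III.1 proof of Cor. III.5 (pp. 347–348)] -/
theorem not_tendsto_zero_of_le_of_infraredBound (hd : 3 ≤ d) {φ : ℕ → ℕ} (hφ : StrictMono φ)
    (G I : ∀ n : ℕ, TorusSite d (2 * φ n + 2) → ℝ) {g₀ B : ℝ}
    (hgap : B * latticeGreen (0 : Literature.Probability.LatticeModels.Site d) < g₀)
    (hpos : ∀ᶠ n in atTop, ∀ k : TorusSite d (2 * φ n + 2),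
      0 ≤ (torusFourier (fun x => (I n x : ℂ)) k).re)
    (hdiag : ∀ᶠ n in atTop, g₀ ≤ I n 0)
    (hIR : ∀ᶠ n in atTop, ∀ k : TorusSite d (2 * φ n + 2), k ≠ 0 →
      dispersion (latticeMomentum (2 * φ n + 2) k) * (torusFourier (fun x => (I n x : ℂ)) k).re ≤ B)
    (hle : ∀ᶠ n in atTop, ∀ x : TorusSite d (2 * φ n + 2), I n x ≤ G n x)
    {Ginf : Literature.Probability.LatticeModels.Site d → ℝ}
    (hlim : ∀ x : Literature.Probability.LatticeModels.Site d,
      Tendsto (fun n => G n (Torus.proj (2 * φ n + 2) x)) atTop (𝓝 (Ginf x))) :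
    ¬ Tendsto Ginf cofinite (𝓝 0) := by
  intro hzero
  set c : ℝ := (g₀ - B * latticeGreen (0 : Literature.Probability.LatticeModels.Site d)) / 2 with hc
  have hc_pos : 0 < c := by rw [hc]; linarith
  have hgap' : 0 < g₀ - B * latticeGreen (0 : Literature.Probability.LatticeModels.Site d) - c := by
    rw [hc]; linarith
  have hproj_sub : ∀ (M : ℕ) (x y : Literature.Probability.LatticeModels.Site d),
      Torus.proj M (x - y) = Torus.proj M x - Torus.proj M y := fun M x y => by
    funext i; simp [Torus.proj]
  have hproj_zero : ∀ M : ℕ, Torus.proj M (0 : Literature.Probability.LatticeModels.Site d) = 0 :=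
    fun M => by funext i; simp [Torus.proj]
  -- `torusGreen 0` is eventually close to `latticeGreen 0`
  obtain ⟨L₁, hL₁⟩ := torusGreen_tendsto_latticeGreen d hd (0 : Literature.Probability.LatticeModels.Site d)
    (ε := (g₀ - B * latticeGreen (0 : Literature.Probability.LatticeModels.Site d) - c) / (|B| + 1))
    (div_pos hgap' (by positivity))
  have hGreen : ∀ᶠ n in atTop, c ≤ g₀ - B * torusGreen (0 : TorusSite d (2 * φ n + 2)) := by
    refine eventually_atTop.2 ⟨L₁, fun n hn => ?_⟩
    have hφn : n ≤ φ n := hφ.id_le n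
    have hL : L₁ ≤ 2 * φ n + 2 := by omega
    have h := hL₁ (2 * φ n + 2) ⟨φ n + 1, by ring⟩ hL
    rw [hproj_zero] at h
    have hB : |B * torusGreen (0 : TorusSite d (2 * φ n + 2)) -
        B * latticeGreen (0 : Literature.Probability.LatticeModels.Site d)| ≤
        g₀ - B * latticeGreen (0 : Literature.Probability.LatticeModels.Site d) - c := by
      rw [← mul_sub, abs_mul]
      calc |B| * |torusGreen (0 : TorusSite d (2 * φ n + 2)) -
            latticeGreen (0 : Literature.Probability.LatticeModels.Site d)|
          ≤ |B| * ((g₀ - B * latticeGreen (0 : Literature.Probability.LatticeModels.Site d) - c) /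
              (|B| + 1)) := mul_le_mul_of_nonneg_left h (abs_nonneg B)
        _ ≤ (|B| + 1) * ((g₀ - B * latticeGreen (0 : Literature.Probability.LatticeModels.Site d) - c) /
              (|B| + 1)) := mul_le_mul_of_nonneg_right (by linarith [abs_nonneg B]) (by positivity)
        _ = g₀ - B * latticeGreen (0 : Literature.Probability.LatticeModels.Site d) - c := by field_simp
    have := (abs_le.1 hB).2
    linarith
  -- block sums of `Ginf` are bounded below through the minorants
  have hblock : ∀ N : ℕ, (#(box d N) : ℝ) ^ 2 * c ≤ ∑ x ∈ box d N, ∑ y ∈ box d N, Ginf (x - y) := by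
    intro N
    have hfin : ∀ᶠ n in atTop, (#(box d N) : ℝ) ^ 2 * c ≤
        ∑ x ∈ box d N, ∑ y ∈ box d N, G n (Torus.proj (2 * φ n + 2) (x - y)) := by
      filter_upwards [hpos, hdiag, hIR, hle, hGreen] with n hposn hdiagn hIRn hlen hGreenn
      have h := sq_mul_le_blockSum (I n) hposn hIRn (box d N)
      calc (#(box d N) : ℝ) ^ 2 * c
          ≤ (#(box d N) : ℝ) ^ 2 * (I n 0 - B * torusGreen (0 : TorusSite d (2 * φ n + 2))) :=
            mul_le_mul_of_nonneg_left (hGreenn.trans (by linarith)) (sq_nonneg _)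
        _ ≤ ∑ x ∈ box d N, ∑ y ∈ box d N,
              I n (Torus.proj (2 * φ n + 2) x - Torus.proj (2 * φ n + 2) y) := h
        _ ≤ ∑ x ∈ box d N, ∑ y ∈ box d N,
              G n (Torus.proj (2 * φ n + 2) x - Torus.proj (2 * φ n + 2) y) :=
            Finset.sum_le_sum fun x _ => Finset.sum_le_sum fun y _ => hlen _
        _ = ∑ x ∈ box d N, ∑ y ∈ box d N, G n (Torus.proj (2 * φ n + 2) (x - y)) := by
            simp_rw [hproj_sub]
    have hsum : Tendsto (fun n => ∑ x ∈ box d N, ∑ y ∈ box d N,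
        G n (Torus.proj (2 * φ n + 2) (x - y))) atTop
        (𝓝 (∑ x ∈ box d N, ∑ y ∈ box d N, Ginf (x - y))) :=
      tendsto_finsetSum _ fun x _ => tendsto_finsetSum _ fun y _ => hlim (x - y)
    exact ge_of_tendsto hsum hfin
  have havg : ∀ N : ℕ, c ≤ (∑ x ∈ box d N, ∑ y ∈ box d N, Ginf (x - y)) / ((#(box d N) : ℝ) ^ 2) := by
    intro N
    have hB : (0 : ℝ) < (#(box d N) : ℝ) ^ 2 := by
      have : (0 : ℝ) < #(box d N) := by exact_mod_cast (box_nonempty d N).card_pos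
      positivity
    rw [le_div_iff₀ hB, mul_comm]
    exact hblock N
  have hlim0 := tendsto_blockAverage_of_tendsto_cofinite d (by omega) hzero
  have := ge_of_tendsto' hlim0 havg
  linarith

/-- **Deconfinement of `ℤ₂` lattice gauge theory at every temporal extent** (Borgs–Seiler's
abelian route): in `d ≥ 3` space dimensions, at temporal extent `L₀ ≥ 1`, electric coupling
`J_E > 0` with `2 K(J_E, L₀) > I_d` (`I_d = latticeGreen 0`, the `∫ dp/ε(p)` constant of the
infrared bound) and ANY magnetic coupling `J_M ≥ 0`, the Polyakov loops have long-range order: no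
thermodynamic limit of `G_L(x)` tends to `0` at spatial infinity
(`FiniteTemperature.HasPolyakovLongRangeOrder`). Proof: `G_L ≥ ⟨σ_0σ_x⟩^{Ising}_{(ℤ/L)^d,K}`
(`isingTorus_le_polyakovCorrelation`), the Ising infrared bound `Ĝ(p) ≤ 1/(2K ε(p))`
(`infraredBound_holds`, Fröhlich–Simon–Spencer) with `Ĝ ≥ 0` (`twoPointFourierTorus_re_nonneg`)
and `G(0) = 1`, and the sum rule in `d ≥ 3` (`not_tendsto_zero_of_le_of_infraredBound`).
[cite: BorgsSeiler1983, §III.3 Lemma III.9 and (III.87) (p. 356); §IV (pp. 358–359)] -/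
theorem _root_.Literature.MathematicalPhysics.QuantumFieldTheory.z2_hasPolyakovLongRangeOrder
    (hd : 3 ≤ d) (L₀ : ℕ) [NeZero L₀] {JE JM : ℝ} (hJE : 0 < JE) (hJM : 0 ≤ JM)
    (hK : latticeGreen (0 : Literature.Probability.LatticeModels.Site d) < 2 * effCoupling JE L₀) :
    HasPolyakovLongRangeOrder d L₀ z2Rep JE JM := by
  obtain ⟨d', rfl⟩ : ∃ d', d = d' + 1 := ⟨d - 1, by omega⟩
  rintro Ginf ⟨φ, hφ, hlim⟩
  set K : ℝ := effCoupling JE L₀ with hKdef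
  have hKpos : 0 < K := effCoupling_pos hJE
  have hev : ∀ᶠ n : ℕ in atTop, 1 ≤ φ n :=
    eventually_atTop.2 ⟨1, fun n hn => hn.trans (hφ.id_le n)⟩
  refine not_tendsto_zero_of_le_of_infraredBound hd hφ
    (fun n => polyakovCorrelation (L₀ := L₀) (L := 2 * φ n + 2) z2Rep JE JM)
    (fun n => torusTwoPoint (isingTorusMeasure (d' + 1) (2 * φ n + 2) K 0))
    (g₀ := 1) (B := 1 / (2 * K)) ?_ ?_ ?_ ?_ ?_ hlim
  · rw [one_div_mul_eq_div, div_lt_one (by positivity)]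
    linarith
  · filter_upwards [hev] with n hn k
    exact twoPointFourierTorus_re_nonneg (by omega) hKpos.le 0 k
  · exact Eventually.of_forall fun n => (torusTwoPoint_zero _).symm.le
  · filter_upwards [hev] with n hn k hk
    have hL2 : 2 * φ n + 2 ≠ 2 := by omega
    have h := infraredBound_holds (d := d' + 1) (L := 2 * φ n + 2) ⟨φ n + 1, by ring⟩ hL2 hKpos k hk
    have hε : 0 < dispersion (latticeMomentum (2 * φ n + 2) k) :=
      lt_of_le_of_ne (dispersion_nonneg _)
        (fun h0 => hk ((dispersion_latticeMomentum_eq_zero_iff_holds k).1 h0.symm))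
    calc dispersion (latticeMomentum (2 * φ n + 2) k) *
          (torusFourier (fun x => (torusTwoPoint (isingTorusMeasure (d' + 1) (2 * φ n + 2) K 0) x : ℂ))
            k).re
        ≤ dispersion (latticeMomentum (2 * φ n + 2) k) *
            (1 / (2 * K * dispersion (latticeMomentum (2 * φ n + 2) k))) :=
          mul_le_mul_of_nonneg_left h hε.le
      _ = 1 / (2 * K) := by field_simp
  · filter_upwards [hev] with n hn x
    exact isingTorus_le_polyakovCorrelation (by omega) hJE.le hJM x

/-! #### An explicit threshold: `K(J_E, L₀) ≥ J_E - log(2L₀)/2` -/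

/-- `1 - tanh J ≤ 2 e^{-2J}`. [folklore] -/
private theorem one_sub_tanh_le (J : ℝ) : 1 - Real.tanh J ≤ 2 * Real.exp (-2 * J) := by
  rw [Real.tanh_eq]
  have hp : 0 < Real.exp J + Real.exp (-J) := by positivity
  have key : 1 - (Real.exp J - Real.exp (-J)) / (Real.exp J + Real.exp (-J)) =
      2 * Real.exp (-J) / (Real.exp J + Real.exp (-J)) := by
    field_simp
    ring
  rw [key, div_le_iff₀ hp]
  have h2 : Real.exp (-2 * J) * Real.exp J = Real.exp (-J) := by
    rw [← Real.exp_add]; congr 1; ring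
  nlinarith [Real.exp_pos J, Real.exp_pos (-J), Real.exp_pos (-2 * J), h2,
    mul_pos (Real.exp_pos (-2 * J)) (Real.exp_pos (-J))]

/-- **Explicit lower bound for the effective coupling**: for `J_E ≥ 1`,
`K(J_E, L₀) ≥ J_E - log(2L₀)/2` (from `1 - (tanh J_E)^{L₀} ≤ L₀(1 - tanh J_E) ≤ 2L₀e^{-2J_E}` and
`artanh a = ½ log((1+a)/(1-a)) ≥ ½ log(1/(1-a))`). [folklore] -/
private theorem effCoupling_ge [NeZero L₀] {JE : ℝ} (hJE : 1 ≤ JE) :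
    JE - Real.log (2 * L₀) / 2 ≤ effCoupling JE L₀ := by
  set t : ℝ := Real.tanh JE with ht
  set r : ℝ := Real.exp (-2 * JE) with hr
  set a : ℝ := t ^ L₀ with ha
  have hL₀ : (1 : ℝ) ≤ L₀ := by exact_mod_cast Nat.one_le_iff_ne_zero.2 (NeZero.ne L₀)
  have hr_pos : 0 < r := Real.exp_pos _
  have hr_half : 2 * r ≤ 1 := by
    have : r ≤ Real.exp (-2) := Real.exp_le_exp.2 (by linarith)
    have h2 : Real.exp (-2) ≤ 1 / 2 := by
      have := Real.exp_one_gt_d9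
      have h4 : Real.exp (-2) * Real.exp 2 = 1 := by rw [← Real.exp_add]; simp
      have h5 : Real.exp 2 = Real.exp 1 * Real.exp 1 := by rw [← Real.exp_add]; norm_num
      nlinarith [Real.exp_pos (-2), Real.exp_pos 1]
    linarith
  have ht1 : t < 1 := Real.tanh_lt_one JE
  have ht0 : 0 ≤ t := tanh_nonneg_of_nonneg (by linarith)
  have htr : 1 - 2 * r ≤ t := by have := one_sub_tanh_le JE; rw [← ht, ← hr] at this; linarith
  have ha1 : a < 1 := by rw [ha]; exact pow_lt_one₀ ht0 ht1 (NeZero.ne L₀)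
  have ha0 : 0 ≤ a := by rw [ha]; exact pow_nonneg ht0 _
  -- Bernoulli: `(1 - 2r)^{L₀} ≥ 1 - 2 L₀ r`
  have hbern : 1 - 2 * L₀ * r ≤ a := by
    have h1 : 1 + (L₀ : ℝ) * (-(2 * r)) ≤ (1 + -(2 * r)) ^ L₀ :=
      one_add_mul_le_pow (by linarith) L₀
    have h2 : (1 + -(2 * r)) ^ L₀ ≤ t ^ L₀ :=
      pow_le_pow_left₀ (by linarith) (by linarith) L₀
    rw [ha]; linarith
  have h1a : 0 < 1 - a := by linarith
  -- `artanh a ≥ ½ log (1/(1-a)) ≥ ½ log (e^{2J}/(2L₀)) = J - log(2L₀)/2`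
  have hart : effCoupling JE L₀ = 1 / 2 * Real.log ((1 + a) / (1 - a)) := by
    rw [effCoupling, ← ht, ← ha]
    exact Real.artanh_eq_half_log ⟨by linarith, ha1.le⟩
  have hq : Real.exp (2 * JE) / (2 * L₀) ≤ (1 + a) / (1 - a) := by
    rw [div_le_div_iff₀ (by positivity) h1a]
    have h3 : Real.exp (2 * JE) * (1 - a) ≤ Real.exp (2 * JE) * (2 * L₀ * r) :=
      mul_le_mul_of_nonneg_left (by linarith) (Real.exp_pos _).le
    have h4 : Real.exp (2 * JE) * (2 * L₀ * r) = 2 * L₀ := by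
      rw [hr, mul_comm (2 * (L₀ : ℝ)) _, ← mul_assoc, ← Real.exp_add]; simp
    nlinarith [Real.exp_pos (2 * JE)]
  have hlog : Real.log (Real.exp (2 * JE) / (2 * L₀)) ≤ Real.log ((1 + a) / (1 - a)) :=
    Real.log_le_log (by positivity) hq
  rw [Real.log_div (Real.exp_pos _).ne' (by positivity), Real.log_exp] at hlog
  rw [hart]
  linarith

/-- **Deconfinement of `ℤ₂` lattice gauge theory at every temporal extent — explicit threshold**:
in `d ≥ 3` space dimensions, at temporal extent `L₀ ≥ 1`, for every electric coupling
`J_E ≥ I_d/2 + log(2L₀)/2 + 1` (`I_d = latticeGreen 0`) and every magnetic coupling `J_M ≥ 0` the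
Polyakov loops of the `ℤ₂` theory have long-range order (since then
`K(J_E,L₀) ≥ J_E - log(2L₀)/2 > I_d/2`). [cite: BorgsSeiler1983, §III.3 (III.87) (p. 356); §IV (pp. 357–359)] -/
theorem _root_.Literature.MathematicalPhysics.QuantumFieldTheory.z2_hasPolyakovLongRangeOrder_of_ge
    (hd : 3 ≤ d) (L₀ : ℕ) [NeZero L₀] {JE JM : ℝ}
    (hJE : latticeGreen (0 : Literature.Probability.LatticeModels.Site d) / 2 + Real.log (2 * L₀) / 2 + 1 ≤ JE)
    (hJM : 0 ≤ JM) : HasPolyakovLongRangeOrder d L₀ z2Rep JE JM := by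
  have hI := latticeGreen_pos d hd (0 : Literature.Probability.LatticeModels.Site d)
  have hlog : 0 ≤ Real.log (2 * L₀) := Real.log_nonneg (by
    have : (1 : ℝ) ≤ L₀ := by exact_mod_cast Nat.one_le_iff_ne_zero.2 (NeZero.ne L₀)
    linarith)
  have hJE1 : 1 ≤ JE := by linarith
  refine z2_hasPolyakovLongRangeOrder hd L₀ (by linarith) hJM ?_
  have := effCoupling_ge (L₀ := L₀) hJE1
  linarith

/-- **Deconfinement of `ℤ₂` lattice gauge theory at every temporal extent, with an explicit
threshold**: in `d ≥ 3` space dimensions, for every `L₀ ≥ 1` there is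
`J₀ = I_d/2 + log(2L₀)/2 + 1 > 0` such that for all `J_E ≥ J₀` and all `J_M ≥ 0` the Polyakov
loops of the `ℤ₂` theory have long-range order — the shape of the `U(N)`/`SU(N)` named fact
`FiniteTemperatureDeconfinement`, for the abelian group `ℤ₂`, PROVED ("confinement will disappear
… provided the temperature is high enough"; the threshold grows like `log L₀`, i.e. is not uniform
in the temperature, as it must: "obviously `g²` cannot be independent of `T` here").
[cite: BorgsSeiler1983, §III.3 (III.87) (p. 356); §IV (pp. 357–359)] -/
theorem _root_.Literature.MathematicalPhysics.QuantumFieldTheory.z2_finiteTemperatureDeconfinement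
    (hd : 3 ≤ d) (L₀ : ℕ) [NeZero L₀] :
    ∃ J₀ : ℝ, 0 < J₀ ∧ ∀ JE JM : ℝ, J₀ ≤ JE → 0 ≤ JM →
      HasPolyakovLongRangeOrder d L₀ z2Rep JE JM := by
  have hI := latticeGreen_pos d hd (0 : Literature.Probability.LatticeModels.Site d)
  have hlog : 0 ≤ Real.log (2 * L₀) := Real.log_nonneg (by
    have : (1 : ℝ) ≤ L₀ := by exact_mod_cast Nat.one_le_iff_ne_zero.2 (NeZero.ne L₀)
    linarith)
  exact ⟨latticeGreen (0 : Literature.Probability.LatticeModels.Site d) / 2 + Real.log (2 * L₀) / 2 + 1,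
    by positivity, fun JE JM hJE hJM => z2_hasPolyakovLongRangeOrder_of_ge hd L₀ hJE hJM⟩

/-! #### Barrier corollaries: the temperature-blind confinement classes are refuted for `ℤ₂`,
unconditionally and at every temporal extent -/

/-- **`ℤ₂`: Polyakov confinement at all couplings is FALSE at every temporal extent `L₀`**
(`d ≥ 3`); unconditional (the `U(N)`/`SU(N)` versions
`FiniteTemperatureDeconfinement.not_polyakovConfinementAtAllCouplings_*` take the named fact as a
hypothesis). [cite: BorgsSeiler1983, §IV (pp. 357–359)] -/
theorem _root_.Literature.MathematicalPhysics.QuantumFieldTheory.z2_not_polyakovConfinementAtAllCouplings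
    (hd : 3 ≤ d) (L₀ : ℕ) [NeZero L₀] : ¬ PolyakovConfinementAtAllCouplings d L₀ z2Rep := by
  intro h
  obtain ⟨J₀, hJ₀, hLRO⟩ := z2_finiteTemperatureDeconfinement hd L₀
  obtain ⟨Ginf, hG⟩ := exists_isThermodynamicLimit (d := d) (L₀ := L₀) z2Rep
    continuous_of_discreteTopology z2Rep_mem_unitaryGroup J₀ 1
  exact hLRO J₀ 1 le_rfl zero_le_one Ginf hG (h J₀ 1 hJ₀ one_pos Ginf hG)

/-- **`ℤ₂`: temperature-blind Polyakov confinement is FALSE** (`d ≥ 3`). [cite: BorgsSeiler1983, §IV (pp. 357–359)] -/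
theorem _root_.Literature.MathematicalPhysics.QuantumFieldTheory.z2_not_temperatureBlindPolyakovConfinement
    (hd : 3 ≤ d) : ¬ TemperatureBlindPolyakovConfinement d z2Rep :=
  fun h => z2_not_polyakovConfinementAtAllCouplings hd 1 (h 1)

/-- **`ℤ₂`: volume-uniform exponential clustering of the Polyakov correlation at all couplings is
FALSE at every temporal extent `L₀`** (`d ≥ 3`): no strong-coupling-type cluster expansion of the
`ℤ₂` theory converges at all `J_E`. [cite: BorgsSeiler1983, §II.4 (II.55)–(II.56) (p. 343); §IV (pp. 357–359)] -/
theorem _root_.Literature.MathematicalPhysics.QuantumFieldTheory.z2_not_uniformClusteringAtAllCouplings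
    (hd : 3 ≤ d) (L₀ : ℕ) [NeZero L₀] : ¬ UniformClusteringAtAllCouplings d L₀ z2Rep :=
  fun h => z2_not_polyakovConfinementAtAllCouplings hd L₀ h.polyakovConfinement

/-- **`ℤ₂`: temperature-blind volume-uniform clustering is FALSE** (`d ≥ 3`). [cite: BorgsSeiler1983, §IV (pp. 357–359)] -/
theorem _root_.Literature.MathematicalPhysics.QuantumFieldTheory.z2_not_temperatureBlindUniformClustering
    (hd : 3 ≤ d) : ¬ TemperatureBlindUniformClustering d z2Rep :=
  fun h => z2_not_temperatureBlindPolyakovConfinement hd h.polyakovConfinement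

end LongRangeOrder

end Z2Thermal

end Literature.MathematicalPhysics.QuantumFieldTheory
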